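import Literature.NumberTheory.ComplexMultiplication.CMOrderIdealClassMonoidCountFormula
import HarnessLib

/-!
# The weak equivalence class monoid counted: `#Wk(𝔯) = Σ_S #W̄k(S) ≥ #`over-orders, with equality iff `𝔯` is Bass

Layer A3 of the Hodge/CM programme (docs/m5/MAPPING.md §1), the "arbitrary order" series.  Marseglia's WEAK
EQUIVALENCE CLASS MONOID `Wk(R)` — the nonzero fractional `R`-ideals modulo `1 ∈ (I:J)(J:I)` (PROP. 4.1 (b),
`CMOrderWeakEquivalence`) — is partitioned by the multiplicator ring, «`Wk(R) = ⊔ W̄k(S)`» over the over-orders `S`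
[Marseglia2019, §4 after Def. 4.2]; the strata `W̄k(S)` were counted in `CMOrderWeakClassesCount` /
`CMOrderGorensteinWeakClassesCount` (`#W̄k(S) = 1` iff `S` Gorenstein).  Here, for the order `𝔯 = endOrder ρ` of any
number field:

* §1 `finite_quot_weak` (`Wk(𝔯)` is finite, a quotient of `ICM(𝔯)`), `natCard_quot_weak_le_natCard_quot_fractionalIdeal`;
* §2 `nonempty_quot_stratum_weak_equiv_fiber`, **`natCard_quot_weak_eq_sum_natCard_quot_stratum_weak`** —
  `#Wk(𝔯) = Σ_S #W̄k(S)` [Marseglia2019, §4 («`Wk(R) = ⊔ W̄k(S)`»), p. 8];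
* §3 `natCard_quot_stratum_weak_pos`, **`card_overorders_le_natCard_quot_weak`** — every over-order is the
  multiplicator ring of a weak class: `#`over-orders `≤ #Wk(𝔯)` («one can also obtain all the over-orders of `R` by
  computing the multiplicator rings of the representatives of `Wk(R)`», Remark 5.4);
* §4 (`𝔯 = endOrder (M_μ)`) **`card_overorders_eq_natCard_quot_weak_iff`** — equality iff `𝔯` is BASS (every
  over-order Gorenstein, i.e. every `W̄k(S)` a singleton) [Marseglia2019, §3 Prop. 3.7 and §4 remark after Def. 4.2]
  (with `CMOrderIdealClassMonoidConductorDivisorSum.card_overorders_le_natCard_quot_fractionalIdeal`: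
  `#`over-orders `≤ #Wk(𝔯) ≤ #ICM(𝔯)`).

Conventions as in `CMOrderWeakClassesCount` (weak equivalence `1 ∈ (M:N)(N:M)`; strata `{M ≠ 0 // ↑(M/M) = S}`; the
over-orders are the subrings `𝔯 ≤ S` module-finite over `ℤ`, `EndOrder.finite_setOf_overorder`; «Bass»:
`∀ M = MM ≠ 0, ∀ I ≠ 0, MI = I → (M:(M:I)) = I`).  Theorems only (no new definitions, no named facts).

## References
* [Marseglia2019] S. Marseglia, *Computing the ideal class monoid of an order*, J. Lond. Math. Soc. 101 (2020),
  arXiv:1805.09671 — §3 Lemma 3.6, Prop. 3.7 p. 6; §4 Prop. 4.1, Def. 4.2 p. 8; §5 Remark 5.4 p. 10.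
* [DadeTausskyZassenhaus1962] E. C. Dade, O. Taussky, H. Zassenhaus, *On the theory of orders …*, Math. Ann. 148
  (1962) — §1 (weak equivalence, «genus»).
-/

noncomputable section

open scoped Classical nonZeroDivisors NumberField Pointwise
open NumberField Module FractionalIdeal

namespace Literature.NumberTheory.ComplexMultiplication

namespace EndOrder

section AnyOrder

variable {K : Type} [Field K] [NumberField K]
variable {ι : Type} [Fintype ι] [DecidableEq ι] [Nonempty ι] {ρ : K →ₐ[ℚ] Matrix ι ι ℚ}
variable [IsFractionRing (endOrder ρ) K]

/-! ## §1 `Wk(𝔯)` is finite -/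

/-- **`Wk(𝔯)` is finite** — a quotient of the finite `ICM(𝔯)` (isomorphic ideals are weakly equivalent).
[cite: Marseglia2019, §4 Def. 4.2 («being weakly equivalent is a necessary condition for being isomorphic»), p. 8] -/
theorem finite_quot_weak :
    Finite (Quot fun M N : {M : FractionalIdeal (endOrder ρ)⁰ K // M ≠ 0} =>
      (1 : K) ∈ (M : FractionalIdeal (endOrder ρ)⁰ K) / N * (N / M)) := by
  haveI := finite_quot_fractionalIdeal (ρ := ρ) (K := K)
  refine Finite.of_surjective (α := Quot fun M N : {M : FractionalIdeal (endOrder ρ)⁰ K // M ≠ 0} =>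
      ∃ x : K, x ≠ 0 ∧ (M : FractionalIdeal (endOrder ρ)⁰ K) = spanSingleton (endOrder ρ)⁰ x * N)
    (Quot.lift (fun M => Quot.mk _ M) fun M N h => Quot.sound (by
      obtain ⟨x, hx, h⟩ := h
      exact one_mem_div_mul_div_of_eq_spanSingleton_mul hx N.2 h)) fun q => ?_
  induction q using Quot.ind with | mk M => ?_
  exact ⟨Quot.mk _ M, rfl⟩

/-- **`#Wk(𝔯) ≤ #ICM(𝔯)`.** [cite: Marseglia2019, §4 Def. 4.2, p. 8] -/
theorem natCard_quot_weak_le_natCard_quot_fractionalIdeal :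
    Nat.card (Quot fun M N : {M : FractionalIdeal (endOrder ρ)⁰ K // M ≠ 0} =>
      (1 : K) ∈ (M : FractionalIdeal (endOrder ρ)⁰ K) / N * (N / M)) ≤
    Nat.card (Quot fun M N : {M : FractionalIdeal (endOrder ρ)⁰ K // M ≠ 0} =>
      ∃ x : K, x ≠ 0 ∧ (M : FractionalIdeal (endOrder ρ)⁰ K) = spanSingleton (endOrder ρ)⁰ x * N) := by
  haveI := finite_quot_fractionalIdeal (ρ := ρ) (K := K)
  refine Nat.card_le_card_of_surjective
    (Quot.lift (fun M => Quot.mk _ M) fun M N h => Quot.sound (by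
      obtain ⟨x, hx, h⟩ := h
      exact one_mem_div_mul_div_of_eq_spanSingleton_mul hx N.2 h)) fun q => ?_
  induction q using Quot.ind with | mk M => ?_
  exact ⟨Quot.mk _ M, rfl⟩

/-! ## §2 `Wk(𝔯) = ⊔_S W̄k(S)`: `#Wk(𝔯) = Σ_S #W̄k(S)` -/

omit [Nonempty ι] in
/-- **`W̄k(S)` is the fibre of `[M] ↦ (M:M)` over `S`** on `Wk(𝔯)` (weakly equivalent ideals have the same
multiplicator ring, PROP. 4.1 (b)⇒(c), so `[M] ↦ (M:M)` is defined on weak classes). [cite: Marseglia2019, §4 Prop.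
4.1 and Def. 4.2 («`W̄k(S)` … the weak equivalence classes `[I]` such that `(I:I) = S`»), p. 8] -/
theorem nonempty_quot_stratum_weak_equiv_fiber (S : Subring K)
    (f : (Quot fun M N : {M : FractionalIdeal (endOrder ρ)⁰ K // M ≠ 0} =>
      (1 : K) ∈ (M : FractionalIdeal (endOrder ρ)⁰ K) / N * (N / M)) → Subring K)
    (hf : ∀ M : {M : FractionalIdeal (endOrder ρ)⁰ K // M ≠ 0},
      ((f (Quot.mk _ M) : Subring K) : Set K) =
        (((M : FractionalIdeal (endOrder ρ)⁰ K) / M : FractionalIdeal (endOrder ρ)⁰ K) : Set K)) :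
    Nonempty ((Quot fun M N : {M : FractionalIdeal (endOrder ρ)⁰ K //
        M ≠ 0 ∧ ((M / M : FractionalIdeal (endOrder ρ)⁰ K) : Set K) = S} =>
      (1 : K) ∈ (M : FractionalIdeal (endOrder ρ)⁰ K) / N * (N / M)) ≃
      {q : Quot fun M N : {M : FractionalIdeal (endOrder ρ)⁰ K // M ≠ 0} =>
        (1 : K) ∈ (M : FractionalIdeal (endOrder ρ)⁰ K) / N * (N / M) // f q = S}) := by
  let φ₀ : {M : FractionalIdeal (endOrder ρ)⁰ K // M ≠ 0 ∧ ((M / M : FractionalIdeal (endOrder ρ)⁰ K) : Set K) = S} →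
      {q : Quot fun M N : {M : FractionalIdeal (endOrder ρ)⁰ K // M ≠ 0} =>
        (1 : K) ∈ (M : FractionalIdeal (endOrder ρ)⁰ K) / N * (N / M) // f q = S} :=
    fun M => ⟨Quot.mk _ ⟨M.1, M.2.1⟩, SetLike.coe_injective ((hf ⟨M.1, M.2.1⟩).trans M.2.2)⟩
  have hφ₀ : ∀ M N : {M : FractionalIdeal (endOrder ρ)⁰ K // M ≠ 0 ∧ ((M / M : FractionalIdeal (endOrder ρ)⁰ K) : Set K) = S},
      (1 : K) ∈ (M : FractionalIdeal (endOrder ρ)⁰ K) / N * (N / M) → φ₀ M = φ₀ N := fun M N h =>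
    Subtype.ext (Quot.sound h)
  refine ⟨Equiv.ofBijective (Quot.lift φ₀ hφ₀) ⟨?_, ?_⟩⟩
  · intro q₁ q₂ h
    induction q₁ using Quot.ind with
    | mk M =>
      induction q₂ using Quot.ind with
      | mk N =>
        have h' : Quot.mk (fun M N : {M : FractionalIdeal (endOrder ρ)⁰ K // M ≠ 0} =>
            (1 : K) ∈ (M : FractionalIdeal (endOrder ρ)⁰ K) / N * (N / M)) ⟨M.1, M.2.1⟩ =
            Quot.mk _ ⟨N.1, N.2.1⟩ := congrArg Subtype.val h
        exact Quot.sound (((equivalence_one_mem_div_mul_div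
          (fun M : FractionalIdeal (endOrder ρ)⁰ K => M ≠ 0) fun _ h => h).eqvGen_iff).1 (Quot.eqvGen_exact h'))
  · rintro ⟨q, hq⟩
    induction q using Quot.ind with
    | mk M =>
      have hM : ((M.1 / M.1 : FractionalIdeal (endOrder ρ)⁰ K) : Set K) = S := by
        rw [← hf M, hq]
      exact ⟨Quot.mk _ ⟨M.1, M.2, hM⟩, rfl⟩

/-- **«`Wk(R) = ⊔ W̄k(S)`», counted: `#Wk(𝔯) = Σ_S #W̄k(S)`** over the over-orders `S` of `𝔯`, for every order of
every number field. [cite: Marseglia2019, §4 («Consider the partition `Wk(R) = ⊔ W̄k(S)`»), p. 8] -/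
theorem natCard_quot_weak_eq_sum_natCard_quot_stratum_weak :
    Nat.card (Quot fun M N : {M : FractionalIdeal (endOrder ρ)⁰ K // M ≠ 0} =>
      (1 : K) ∈ (M : FractionalIdeal (endOrder ρ)⁰ K) / N * (N / M)) =
      ∑ S ∈ (finite_setOf_overorder (ρ := ρ) (K := K)).toFinset,
        Nat.card (Quot fun M N : {M : FractionalIdeal (endOrder ρ)⁰ K //
            M ≠ 0 ∧ ((M / M : FractionalIdeal (endOrder ρ)⁰ K) : Set K) = S} =>
          (1 : K) ∈ (M : FractionalIdeal (endOrder ρ)⁰ K) / N * (N / M)) := by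
  classical
  have hmr : ∀ M : {M : FractionalIdeal (endOrder ρ)⁰ K // M ≠ 0}, ∃ S : Subring K,
      endOrder ρ ≤ S ∧ Module.Finite ℤ S ∧ (S : Set K) = ((M.1 / M.1 : FractionalIdeal (endOrder ρ)⁰ K) : Set K) :=
    fun M => exists_overorder_coe_eq_div_self M.2
  choose mr hmr𝔯 hmrfin hmrS using hmr
  have hresp : ∀ M N : {M : FractionalIdeal (endOrder ρ)⁰ K // M ≠ 0},
      (1 : K) ∈ (M : FractionalIdeal (endOrder ρ)⁰ K) / N * (N / M) → mr M = mr N := fun M N h => by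
    apply SetLike.coe_injective
    rw [hmrS, hmrS, div_self_eq_div_self_of_one_mem M.2 N.2 h]
  set f : (Quot fun M N : {M : FractionalIdeal (endOrder ρ)⁰ K // M ≠ 0} =>
      (1 : K) ∈ (M : FractionalIdeal (endOrder ρ)⁰ K) / N * (N / M)) → Subring K := Quot.lift mr hresp with hfdef
  have hfS : ∀ q, f q ∈ (finite_setOf_overorder (ρ := ρ) (K := K)).toFinset := by
    intro q
    induction q using Quot.ind with
    | mk M =>
      rw [Set.Finite.mem_toFinset]
      exact ⟨hmr𝔯 M, hmrfin M⟩
  haveI := finite_quot_weak (ρ := ρ) (K := K)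
  letI := Fintype.ofFinite (Quot fun M N : {M : FractionalIdeal (endOrder ρ)⁰ K // M ≠ 0} =>
      (1 : K) ∈ (M : FractionalIdeal (endOrder ρ)⁰ K) / N * (N / M))
  rw [Nat.card_eq_fintype_card, ← Finset.card_univ, Finset.card_eq_sum_card_fiberwise fun q _ => hfS q]
  refine Finset.sum_congr rfl fun S _ => ?_
  rw [← Fintype.card_subtype, ← Nat.card_eq_fintype_card]
  exact Nat.card_congr (nonempty_quot_stratum_weak_equiv_fiber S f fun M => hmrS M).some.symm

/-! ## §3 Every over-order is the multiplicator ring of a weak class: `#`over-orders `≤ #Wk(𝔯)` -/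

/-- **`1 ≤ #W̄k(S)`** for every over-order `S` (the class of `S` itself). [cite: Marseglia2019, §5 («`[S]` and
`[Sᵗ]`»), p. 10] -/
theorem natCard_quot_stratum_weak_pos {S : Subring K} (h𝔯S : endOrder ρ ≤ S) (hfin : Module.Finite ℤ S) :
    0 < Nat.card (Quot fun M N : {M : FractionalIdeal (endOrder ρ)⁰ K //
        M ≠ 0 ∧ ((M / M : FractionalIdeal (endOrder ρ)⁰ K) : Set K) = S} =>
      (1 : K) ∈ (M : FractionalIdeal (endOrder ρ)⁰ K) / N * (N / M)) := by
  haveI := finite_quot_stratum_weak (ρ := ρ) (K := K) S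
  obtain ⟨P, hP0, hPP, hPS⟩ := exists_fractionalIdeal_coe_eq_subring h𝔯S hfin
  haveI : Nonempty (Quot fun M N : {M : FractionalIdeal (endOrder ρ)⁰ K //
        M ≠ 0 ∧ ((M / M : FractionalIdeal (endOrder ρ)⁰ K) : Set K) = S} =>
      (1 : K) ∈ (M : FractionalIdeal (endOrder ρ)⁰ K) / N * (N / M)) :=
    ⟨Quot.mk _ ⟨P, hP0, by rw [div_self_eq_of_mul_self_eq_endOrder hP0 hPP, hPS]⟩⟩
  exact Nat.card_pos

/-- **`#`(over-orders of `𝔯`) `≤ #Wk(𝔯)`** — «one can also obtain all the over-orders of `R` by computing the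
multiplicator rings of the representatives of `Wk(R)`». [cite: Marseglia2019, §5 Remark 5.4, p. 10] -/
theorem card_overorders_le_natCard_quot_weak :
    (finite_setOf_overorder (ρ := ρ) (K := K)).toFinset.card ≤
      Nat.card (Quot fun M N : {M : FractionalIdeal (endOrder ρ)⁰ K // M ≠ 0} =>
        (1 : K) ∈ (M : FractionalIdeal (endOrder ρ)⁰ K) / N * (N / M)) := by
  rw [natCard_quot_weak_eq_sum_natCard_quot_stratum_weak, Finset.card_eq_sum_ones]
  refine Finset.sum_le_sum fun S hS => ?_
  rw [Set.Finite.mem_toFinset] at hS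
  exact natCard_quot_stratum_weak_pos hS.1 hS.2

end AnyOrder

end EndOrder

/-! ## §4 `#`over-orders `= #Wk(𝔯)` iff `𝔯` is Bass -/

namespace CMTypeLattice

section Bass

variable {K : Type} [Field K] [NumberField K]
variable {ι : Type} [Fintype ι] [DecidableEq ι] (μ : Basis ι ℚ K)
variable [IsFractionRing (endOrder (Algebra.leftMulMatrix μ)) K]

/-- **All `W̄k(S)` are singletons iff `𝔯` is Bass** (every over-order `M = MM ≠ 0` Gorenstein).
[cite: Marseglia2019, §3 Prop. 3.7 and §4 remark after Def. 4.2, pp. 6, 8] -/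
theorem forall_natCard_quot_stratum_weak_eq_one_iff :
    (∀ S ∈ (EndOrder.finite_setOf_overorder (ρ := Algebra.leftMulMatrix μ) (K := K)).toFinset,
      Nat.card (Quot fun M N : {M : FractionalIdeal (endOrder (Algebra.leftMulMatrix μ))⁰ K //
          M ≠ 0 ∧ ((M / M : FractionalIdeal (endOrder (Algebra.leftMulMatrix μ))⁰ K) : Set K) = S} =>
        (1 : K) ∈ (M : FractionalIdeal (endOrder (Algebra.leftMulMatrix μ))⁰ K) / N * (N / M)) = 1) ↔
    ∀ M : FractionalIdeal (endOrder (Algebra.leftMulMatrix μ))⁰ K, M ≠ 0 → M * M = M →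
      ∀ I : FractionalIdeal (endOrder (Algebra.leftMulMatrix μ))⁰ K, I ≠ 0 → M * I = I → M / (M / I) = I := by
  haveI : Nonempty ι := μ.index_nonempty
  constructor
  · intro h M hM0 hMM
    obtain ⟨S, h𝔬S, hfin, hSM⟩ := (EndOrder.mul_self_eq_iff_exists_overorder hM0).1 hMM
    have hS : S ∈ (EndOrder.finite_setOf_overorder (ρ := Algebra.leftMulMatrix μ) (K := K)).toFinset := by
      rw [Set.Finite.mem_toFinset]
      exact ⟨h𝔬S, hfin⟩
    exact (natCard_quot_stratum_weak_eq_one_iff_of_overorder μ h𝔬S hfin).1 (h S hS) M hM0 hMM hSM.symm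
  · intro h S hS
    rw [Set.Finite.mem_toFinset] at hS
    exact (natCard_quot_stratum_weak_eq_one_iff_of_overorder μ hS.1 hS.2).2 fun M hM0 hMM _ => h M hM0 hMM

/-- **`#`over-orders `= #Wk(𝔯)` IF AND ONLY IF `𝔯` is Bass** (e.g. every quadratic order; then `Wk(𝔯)` is "the set
of over-orders"). [cite: Marseglia2019, §3 Prop. 3.7, §4 («`Wk(R) = ⊔ W̄k(S)`», «`W̄k(S) = {[S]}` iff `S` is
Gorenstein»), pp. 6, 8] -/
theorem card_overorders_eq_natCard_quot_weak_iff :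
    (EndOrder.finite_setOf_overorder (ρ := Algebra.leftMulMatrix μ) (K := K)).toFinset.card =
      Nat.card (Quot fun M N : {M : FractionalIdeal (endOrder (Algebra.leftMulMatrix μ))⁰ K // M ≠ 0} =>
        (1 : K) ∈ (M : FractionalIdeal (endOrder (Algebra.leftMulMatrix μ))⁰ K) / N * (N / M)) ↔
    ∀ M : FractionalIdeal (endOrder (Algebra.leftMulMatrix μ))⁰ K, M ≠ 0 → M * M = M →
      ∀ I : FractionalIdeal (endOrder (Algebra.leftMulMatrix μ))⁰ K, I ≠ 0 → M * I = I → M / (M / I) = I := by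
  haveI : Nonempty ι := μ.index_nonempty
  rw [← forall_natCard_quot_stratum_weak_eq_one_iff μ, EndOrder.natCard_quot_weak_eq_sum_natCard_quot_stratum_weak,
    Finset.card_eq_sum_ones, Finset.sum_eq_sum_iff_of_le fun S hS => ?_]
  · exact forall₂_congr fun S _ => eq_comm
  · rw [Set.Finite.mem_toFinset] at hS
    exact EndOrder.natCard_quot_stratum_weak_pos hS.1 hS.2

/-- **For a Bass order `#Wk(𝔯) = #`over-orders.** [cite: Marseglia2019, §3 Prop. 3.7, p. 6] -/
theorem natCard_quot_weak_eq_card_overorders_of_forall_overorder_div_div_eq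
    (h : ∀ M : FractionalIdeal (endOrder (Algebra.leftMulMatrix μ))⁰ K, M ≠ 0 → M * M = M →
      ∀ I : FractionalIdeal (endOrder (Algebra.leftMulMatrix μ))⁰ K, I ≠ 0 → M * I = I → M / (M / I) = I) :
    Nat.card (Quot fun M N : {M : FractionalIdeal (endOrder (Algebra.leftMulMatrix μ))⁰ K // M ≠ 0} =>
        (1 : K) ∈ (M : FractionalIdeal (endOrder (Algebra.leftMulMatrix μ))⁰ K) / N * (N / M)) =
      (EndOrder.finite_setOf_overorder (ρ := Algebra.leftMulMatrix μ) (K := K)).toFinset.card :=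
  ((card_overorders_eq_natCard_quot_weak_iff μ).2 h).symm

end Bass

end CMTypeLattice

end Literature.NumberTheory.ComplexMultiplication
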